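import Literature.AnabelianGeometry.EtaleTheta.FrobenioidCyclotomicRigidityProjGalois
import Literature.AnabelianGeometry.EtaleTheta.Thm56SubdagStatements
import HarnessLib

/-!
# [EtTh] Prop. 5.5 / Thm. 5.6 (i) sub-DAG: the `P`-typed input predicates ON THE v2 SUBQUOTIENT RECORD `ThetaSubquotientProjGalois`
# (surjective at Galois objects only) — additive twins of abc-iut-L2-t4 / w5-d020's `Thm56SubdagStatements`, zero edit to the originals

Mochizuki, *The étale theta function and its Frobenioid-theoretic manifestations*, Publ. RIMS **45** (2009), Prop. 5.5 p. 327 (PDF p. 101),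
Thm. 5.6 pp. 328–329 (PDF pp. 102–103) [cite: MochizukiEtTh2009, Prop 5.5 p.327 (PDF p.101)] [cite: MochizukiEtTh2009, Thm 5.6 p.328 (PDF p.102)].

abc-iut cell, layer L2, seat abc-iut-w6-d079 (gen 6), row «PROJ-SURJ-PLAN-A» sequel «(w1f)» (GAP-LEDGER G-w4d042g3-1 plan (a) carried into the
Prop. 5.5 / Thm. 5.6 (i) assembly).  abc-iut-L2-t4 / w5-d020's sub-DAG statements file `Thm56SubdagStatements.lean` types five INPUT PREDICATES of the
Prop. 5.5 / Thm. 5.6 (i) assembly over the binder `(P : ThetaSubquotientProj 𝔉)` — abc-iut-L2-t4's v1 subquotient record, which asks surjectivity at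
EVERY base object and is EMPTY at abc-iut-L2-t9's carrier over the root model (p476337) — although each predicate reads `P` only through
`P.pre` / `P.proj` at `Base(B_N)`.  THIS FILE (class (b): definitions = the five twins; nothing landed is edited or restated) types the same predicates
over abc-iut-w6-d079's v2 record `ThetaSubquotientProjGalois 𝔉 Gal` (p481123; INHABITED at every `ofSetting` carrier, p481568):
`EtaTautologicalGal`, `UnitsCentralUnderLDeltaGal`, `CyclotomeCentralUnderLDeltaGal`, `DeltaTransportCompatGal`, `LDeltaCoveredGal` (formulas
VERBATIM), with the three companion lemmas re-run verbatim (`cyclotomeCentral_of_unitsCentral_gal`, `sgpCup_comm_units_of_gal`,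
`isKummerDetermined_of_thetaPair_gal` — the latter concluding the v2 Prop. 5.5 clause `ThetaSubquotientProjGalois.IsKummerDetermined`), and the
`Iff.rfl` bridges `…Gal_toGalois_iff` showing that on a forgotten v1 record (`ThetaSubquotientProj.toGalois`) each twin IS the original; and the v2
form of abc-iut-L2-t4's Prop. 5.5 statement itself, `ThetaSubquotientProjGalois.CyclotomicRigidity` (existence ∧ uniqueness), with its bridge.  The sub-DAG
PROOFS on the v2 record (`cyclotomicRigidity_of_sub`, `transportAtBN_of`, `cyclotomicRigidityPreserved_of_sub`) are the proof-only sequel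
`Discharge/Sec5Thm56SubdagProofsGalois.lean`.

HONEST FRAMING: a typing repair of the cell's OWN records (weaker quantifier on `P`, as print uses it); predicates only, nothing asserted; nothing of
[EtTh] (refereed) is claimed; no side is taken on [IUTchIII] Cor. 3.12; typed ≠ proved.
-/

namespace Literature.AnabelianGeometry.EtaleTheta

open CategoryTheory
open FrobenioidCyclotomicRigidity

universe w v v' u u'

namespace FrobenioidCyclotomicRigidity

namespace ThetaSubquotientProjGalois

variable {C : Type u} [Category.{v} C] {D : Type u'} [Category.{v'} D] {𝔉 : ThetaFrobenioid.{w} C D} {Gal : D → Prop}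

/-- **[EtTh] Proposition 5.5 (Frobenioid-theoretic Cyclotomic Rigidity) on the v2 record** — abc-iut-L2-t4's `CyclotomicRigidity`
(l.145–148: existence ∧ uniqueness of a rigidity family that is Kummer-determined on `B_N` and functorial for linear morphisms) VERBATIM
with `P : ThetaSubquotientProjGalois 𝔉 Gal` and the v2 clause `IsKummerDetermined`. [cite: MochizukiEtTh2009, Prop 5.5 p.327 (PDF p.101)] -/
def CyclotomicRigidity (P : ThetaSubquotientProjGalois 𝔉 Gal) (hB : 𝔉.IsThetaSaturated 𝔉.BN) : Prop :=
  (∃ ρ : RigidityFamily 𝔉, P.IsKummerDetermined ρ hB ∧ IsFunctorialLinear 𝔉 ρ) ∧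
    ∀ ρ ρ' : RigidityFamily 𝔉, P.IsKummerDetermined ρ hB → IsFunctorialLinear 𝔉 ρ →
      P.IsKummerDetermined ρ' hB → IsFunctorialLinear 𝔉 ρ' → ρ = ρ'

/-- On a forgotten v1 record the v2 Prop. 5.5 statement IS abc-iut-L2-t4's (`Iff.rfl`). [cite: MochizukiEtTh2009, Prop 5.5 p.327 (PDF p.101)] -/
theorem cyclotomicRigidity_toGalois_iff (Gal : D → Prop) (P : ThetaSubquotientProj 𝔉) (hB : 𝔉.IsThetaSaturated 𝔉.BN) :
    (P.toGalois Gal).CyclotomicRigidity hB ↔ FrobenioidCyclotomicRigidity.CyclotomicRigidity 𝔉 P hB :=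
  Iff.rfl

end ThetaSubquotientProjGalois

end FrobenioidCyclotomicRigidity

namespace ThetaFrobenioid

namespace Thm56Sub

variable {C : Type u} [Category.{v} C] {D : Type u'} [Category.{v'} D] (𝔉 : ThetaFrobenioid.{w} C D) {Gal : D → Prop}

/-- (v2 twin on `ThetaSubquotientProjGalois 𝔉 Gal` of abc-iut-L2-t4/w5-d020's `EtaTautological`.) **EtTh:Prop5.5/P55-L02** (p.327 (PDF p.101) l.−3 – p.328 l.1: «it follows from the detailed description of
the "étale theta class" in Proposition 1.3 that the resulting Kummer class [cf. Proposition 5.2, (iii)]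
determines an isomorphism `(l·Δ_Θ)_{S″} ⊗ ℤ/Nℤ ⥲ μ_N(S″)`»).  CONTENT of the appeal to Prop. 1.3 (= Prop. 1.5
(iii): `η̈^Θ` restricts on `Δ_Θ` to the identity class `log(Θ)`, abc-iut-L2-t1 `ThetaSetting.logTheta` /
`ThetaCohomology.Prop15iii`), read mod `N` on `H_{B_N}`: on the part `P.pre` of `H_{B_N}` lying over
`(l·Δ_Θ)_{B_N}` the cocycle `η` of Prop. 5.2 (iii) (MERGE-PLAN row 6 pin) IS the projection `h ↦ [proj h]`.
OPEN at the model (owner ∅; W3-L2-01 / row 6). [cite: MochizukiEtTh2009, Prop 5.5 proof p.327 (PDF p.101)] -/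
def EtaTautologicalGal (P : ThetaSubquotientProjGalois 𝔉 Gal) (η : 𝔉.HB → 𝔉.lDeltaModN 𝔉.BN) : Prop :=
  ∀ (h : 𝔉.HB) (hh : (h : Aut (𝔉.base.obj 𝔉.BN)) ∈ P.pre (𝔉.base.obj 𝔉.BN)),
    η h = QuotientGroup.mk (P.proj _ ⟨h, hh⟩)

/-- (v2 twin of `UnitsCentralUnderLDelta`.) **EtTh:Thm5.6(i)/T56-L09b** (= **EtTh:Prop5.5/P55-L02b**) (p.329 (PDF p.103) l.19–21: «observing that the
Kummer class of the "constant function" `u` does not affect the restriction of the resulting Kummer classes to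
`(l·Δ_Θ)_{S₂}`, `(l·Δ_Θ)_{T₂}`»): for `g ∈ Aut_D(B_N^bs)` in the part `P.pre` over `(l·Δ_Θ)_{B_N}` — the image
of the GEOMETRIC fundamental group (§1 p.238 (PDF p.12): `l·Δ_Θ ⊆ Δ^tp_X` and `Ker(Π^tp_X ↠ (Π^tp_X)^Θ) ⊆
Δ^tp_X`) — the lift `s^⊓-gp_N(g) ∈ Aut_C(B_N)` COMMUTES with the units `O^×(B_N)` (the constants of the tempered
Frobenioid, on which the geometric fundamental group acts trivially; cf. Lemma 5.8 p.331: the units on which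
`Π^tp_Y` acts through `μ_N` are `(O_K^×)^{1/N}`, abc-iut-L2-t4 `ConstantsActByCyclotome`).  Equivalently (d4
`kummerCocycle_eq_one_iff`) the Kummer cocycle of every unit is trivial on that part.  OPEN at the model
(owner ∅; W3-L2-01).  [cite: MochizukiEtTh2009, Thm 5.6 proof p.329 (PDF p.103); §1 p.238 (PDF p.12)] -/
def UnitsCentralUnderLDeltaGal (P : ThetaSubquotientProjGalois 𝔉 Gal) : Prop :=
  ∀ g ∈ P.pre (𝔉.base.obj 𝔉.BN), ∀ u ∈ 𝔉.units 𝔉.BN, 𝔉.sgpCap g * u = u * 𝔉.sgpCap g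

/-- (v2 twin of `CyclotomeCentralUnderLDelta`.) **P55-L02b, cyclotome form**: the lifts `s^⊓-gp_N(g)`, `g` over `(l·Δ_Θ)_{B_N}`, commute with `μ_N(B_N)`.
[cite: MochizukiEtTh2009, Prop 5.5 proof p.327 (PDF p.101)] -/
def CyclotomeCentralUnderLDeltaGal (P : ThetaSubquotientProjGalois 𝔉 Gal) : Prop :=
  ∀ g ∈ P.pre (𝔉.base.obj 𝔉.BN), ∀ u ∈ 𝔉.muTorsion 𝔉.BN 𝔉.N, 𝔉.sgpCap g * u = u * 𝔉.sgpCap g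

/-- (v2 twin.) `μ_N(B_N) ⊆ O^×(B_N)`, so `UnitsCentralUnderLDeltaGal ⇒ CyclotomeCentralUnderLDeltaGal`.
[cite: MochizukiEtTh2009, Prop 5.5 proof p.327 (PDF p.101)] -/
theorem cyclotomeCentral_of_unitsCentral_gal {P : ThetaSubquotientProjGalois 𝔉 Gal} (h : UnitsCentralUnderLDeltaGal 𝔉 P) :
    CyclotomeCentralUnderLDeltaGal 𝔉 P :=
  fun g hg u hu => h g hg u (𝔉.muTorsion_le_units 𝔉.BN 𝔉.N hu)

/-- (v2 twin of `sgpCup_comm_units_of`.) The `s^⊔-gp_N`-lifts commute with the units as well, on the part over `(l·Δ_Θ)_{B_N}`: `s^⊔-gp_N(h) =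
d(h)⁻¹ · s^⊓-gp_N(h)` with `d(h) := s^⊓-gp_N(h)·s^⊔-gp_N(h)⁻¹ ∈ μ_N(B_N) ⊆ O^×(B_N)` (Prop. 4.3 (iii), abc-iut-L2-t4's
`BiKummerDifferenceMem`) and `O^×(B_N)` is abelian ([FrdI] Rmk. 1.3.1).
[cite: MochizukiEtTh2009, Thm 5.6 proof p.329 (PDF p.103)] -/
theorem sgpCup_comm_units_of_gal {P : ThetaSubquotientProjGalois 𝔉 Gal} (hc : UnitsCentralUnderLDeltaGal 𝔉 P)
    (hdiff : 𝔉.BiKummerDifferenceMem) (h : 𝔉.HB)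
    (hh : (h : Aut (𝔉.base.obj 𝔉.BN)) ∈ P.pre (𝔉.base.obj 𝔉.BN)) {u : Aut 𝔉.BN} (hu : u ∈ 𝔉.units 𝔉.BN) :
    𝔉.sgpCup h * u = u * 𝔉.sgpCup h := by
  have hd : 𝔉.sgpCap (h : Aut (𝔉.base.obj 𝔉.BN)) * (𝔉.sgpCup h)⁻¹ ∈ 𝔉.units 𝔉.BN :=
    𝔉.muTorsion_le_units 𝔉.BN 𝔉.N ((𝔉.biKummerDifferenceMem_iff.mp hdiff) h)
  set d := 𝔉.sgpCap (h : Aut (𝔉.base.obj 𝔉.BN)) * (𝔉.sgpCup h)⁻¹ with hd_def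
  have hcup : 𝔉.sgpCup h = d⁻¹ * 𝔉.sgpCap (h : Aut (𝔉.base.obj 𝔉.BN)) := by
    rw [hd_def, mul_inv_rev, inv_inv, inv_mul_cancel_right]
  have hcomm : d⁻¹ * u = u * d⁻¹ :=
    setLike_mul_comm (s := 𝔉.units 𝔉.BN) ((𝔉.units 𝔉.BN).inv_mem hd) hu
  rw [hcup, mul_assoc, hc _ hh u hu, ← mul_assoc, hcomm, mul_assoc]

/-- (v2 twin of `isKummerDetermined_of_thetaPair`, concluding the v2 clause `ThetaSubquotientProjGalois.IsKummerDetermined`.)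
**EtTh:Prop5.5/P55-L03 — Prop. 5.5, EXISTENCE at the codomain `B_N`, DERIVED** (p.327 l.−6 – p.328 l.1:
«… the resulting Kummer class … determines an isomorphism `(l·Δ_Θ)_{S″} ⊗ ℤ/Nℤ ⥲ μ_N(S″)`»): if the bi-Kummer
difference cocycle is `ν ∘ η` up to a `μ_N(B_N)`-coboundary (Prop. 5.2 (iii), abc-iut-L2-t4's
`ThetaPairKummerClass η ν`, print's orientation), `η` is tautological on the `Δ`-part (P55-L02) and that part
centralises `μ_N(B_N)` (P55-L02b), then EVERY candidate family `ρ` with `ρ_{B_N} = ν` is Kummer-determined on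
`B_N` in the sense of abc-iut-L2-t4's `IsKummerDetermined` — i.e. the "second Kummer class" pins `ρ_{B_N}` to the
isomorphism `ν`.  [cite: MochizukiEtTh2009, Prop 5.5 p.327 (PDF p.101)] -/
theorem isKummerDetermined_of_thetaPair_gal (P : ThetaSubquotientProjGalois 𝔉 Gal) {η : 𝔉.HB → 𝔉.lDeltaModN 𝔉.BN}
    {ν : 𝔉.lDeltaModN 𝔉.BN ≃* 𝔉.muTorsion 𝔉.BN 𝔉.N}
    (hK : FrobenioidThetaBiKummer.ThetaPairKummerClass 𝔉 η ν) (hη : EtaTautologicalGal 𝔉 P η)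
    (hc : CyclotomeCentralUnderLDeltaGal 𝔉 P) (ρ : RigidityFamily 𝔉) (hB : 𝔉.IsThetaSaturated 𝔉.BN)
    (hρB : ∀ x, ρ 𝔉.BN hB x = ν x) : P.IsKummerDetermined ρ hB := by
  intro h hh
  obtain ⟨u, hu, hall⟩ := hK
  have hcomm : 𝔉.sgpCap (h : Aut (𝔉.base.obj 𝔉.BN)) * u = u * 𝔉.sgpCap (h : Aut (𝔉.base.obj 𝔉.BN)) :=
    hc _ hh u hu
  have hcob : 𝔉.sgpCap (h : Aut (𝔉.base.obj 𝔉.BN)) * u * (𝔉.sgpCap (h : Aut (𝔉.base.obj 𝔉.BN)))⁻¹ * u⁻¹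
      = 1 := by
    rw [hcomm, mul_inv_cancel_right, mul_inv_cancel]
  rw [hρB, hall h, hcob, one_mul, hη h hh]

/-- (v2 twin of `DeltaTransportCompat`.) **EtTh:Thm5.6(i)/T56-L09c** (p.329 (PDF p.103) l.1 «it follows from Propositions 2.4, 2.6 that `Ψ` preserves
"`(l·Δ_Θ)_{(−)}`"», with l.17–21): at `B_N`, the abstract transport `aΨ` of `(l·Δ_Θ) ⊗ ℤ/Nℤ` induced by `Ψ`
(abc-iut-L2-d4's PARAMETER of `Discharge/Sec5Thm56`), read back on `B_N` through `β : Ψ(B_N) ⥲ B_N`, is INDUCED BY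
THE BASE TRANSPORT `θ` of `Aut_D(B_N^bs)` (the `θ` of abc-iut-L2-t4's `StrvTransport Ψ α e θ`, Thm. 4.4 (iv),
normalised so that `Ψ(s^⊓_N)` transports to `e ≫ s^⊓_N` on the nose): `θ` preserves the part `P.pre` over
`(l·Δ_Θ)_{B_N}` and `Δ-push(β)(aΨ_{B_N}[proj g]) = [proj (θ g)]`.  Both sides come from the one outer automorphism
of `Π^tp_X` induced by `Ψ^bs` ([SemiAnbd] Prop. 3.2, T56-L02).  OPEN at the model (owner ∅; abc-iut-L2-t9
`thetaSubquotientStub` / `galoisSurj` naturality, W3-L2-01).  [cite: MochizukiEtTh2009, Thm 5.6 proof p.329 (PDF p.103)] -/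
def DeltaTransportCompatGal (Ψ : C ≌ C) (β : Ψ.functor.obj 𝔉.BN ≅ 𝔉.BN)
    (aΨ : ∀ S : C, 𝔉.lDeltaModN S ≃* 𝔉.lDeltaModN (Ψ.functor.obj S))
    (θ : Aut (𝔉.base.obj 𝔉.BN) ≃* Aut (𝔉.base.obj 𝔉.BN)) (P : ThetaSubquotientProjGalois 𝔉 Gal) : Prop :=
  ∀ (g : Aut (𝔉.base.obj 𝔉.BN)) (hg : g ∈ P.pre (𝔉.base.obj 𝔉.BN)),
    ∃ hθg : θ g ∈ P.pre (𝔉.base.obj 𝔉.BN),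
      𝔉.lDeltaModNMap β.hom (aΨ 𝔉.BN (QuotientGroup.mk (P.proj _ ⟨g, hg⟩))) =
        QuotientGroup.mk (P.proj _ ⟨θ g, hθg⟩)

/-- (v2 twin of `LDeltaCovered`.) **Coverage** (abc-iut-L2-t11's hypothesis `hcov` of `Discharge/Sec5RigidityGlue`, recorded here by name for
the assembly rows P55-A / T56-L09): the part of `H_{B_N}` over `(l·Δ_Θ)_{B_N}` maps ONTO `(l·Δ_Θ)_{B_N} ⊗ ℤ/Nℤ`
(§1 p.238 (PDF p.12): `Δ_Θ` is a quotient of `Π^tp_Ÿ`).  [cite: MochizukiEtTh2009, §1 p.238 (PDF p.12)] -/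
def LDeltaCoveredGal (P : ThetaSubquotientProjGalois 𝔉 Gal) : Prop :=
  ∀ x : 𝔉.lDeltaModN 𝔉.BN, ∃ (h : 𝔉.HB) (hh : (h : Aut (𝔉.base.obj 𝔉.BN)) ∈ P.pre (𝔉.base.obj 𝔉.BN)),
    (QuotientGroup.mk (P.proj _ ⟨h, hh⟩) : 𝔉.lDeltaModN 𝔉.BN) = x


/-! ### The v2 predicates on a forgotten v1 record ARE the v1 predicates (`Iff.rfl`): re-keying is a binder-type change -/

/-- `EtaTautologicalGal` on `P.toGalois` is `EtaTautological`. [cite: MochizukiEtTh2009, Prop 5.5 proof p.327 (PDF p.101)] -/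
theorem etaTautologicalGal_toGalois_iff (Gal : D → Prop) (P : ThetaSubquotientProj 𝔉)
    (η : 𝔉.HB → 𝔉.lDeltaModN 𝔉.BN) :
    EtaTautologicalGal 𝔉 (P.toGalois Gal) η ↔ EtaTautological 𝔉 P η := Iff.rfl

/-- `UnitsCentralUnderLDeltaGal` on `P.toGalois` is `UnitsCentralUnderLDelta`. [cite: MochizukiEtTh2009, Thm 5.6 proof p.329 (PDF p.103)] -/
theorem unitsCentralUnderLDeltaGal_toGalois_iff (Gal : D → Prop) (P : ThetaSubquotientProj 𝔉) :
    UnitsCentralUnderLDeltaGal 𝔉 (P.toGalois Gal) ↔ UnitsCentralUnderLDelta 𝔉 P := Iff.rfl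

/-- `CyclotomeCentralUnderLDeltaGal` on `P.toGalois` is `CyclotomeCentralUnderLDelta`. [cite: MochizukiEtTh2009, Prop 5.5 proof p.327 (PDF p.101)] -/
theorem cyclotomeCentralUnderLDeltaGal_toGalois_iff (Gal : D → Prop) (P : ThetaSubquotientProj 𝔉) :
    CyclotomeCentralUnderLDeltaGal 𝔉 (P.toGalois Gal) ↔ CyclotomeCentralUnderLDelta 𝔉 P := Iff.rfl

/-- `DeltaTransportCompatGal` on `P.toGalois` is `DeltaTransportCompat`. [cite: MochizukiEtTh2009, Thm 5.6 proof p.329 (PDF p.103)] -/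
theorem deltaTransportCompatGal_toGalois_iff (Gal : D → Prop) (Ψ : C ≌ C) (β : Ψ.functor.obj 𝔉.BN ≅ 𝔉.BN)
    (aΨ : ∀ S : C, 𝔉.lDeltaModN S ≃* 𝔉.lDeltaModN (Ψ.functor.obj S))
    (θ : Aut (𝔉.base.obj 𝔉.BN) ≃* Aut (𝔉.base.obj 𝔉.BN)) (P : ThetaSubquotientProj 𝔉) :
    DeltaTransportCompatGal 𝔉 Ψ β aΨ θ (P.toGalois Gal) ↔ DeltaTransportCompat 𝔉 Ψ β aΨ θ P := Iff.rfl

/-- `LDeltaCoveredGal` on `P.toGalois` is `LDeltaCovered`. [cite: MochizukiEtTh2009, §1 p.238 (PDF p.12)] -/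
theorem lDeltaCoveredGal_toGalois_iff (Gal : D → Prop) (P : ThetaSubquotientProj 𝔉) :
    LDeltaCoveredGal 𝔉 (P.toGalois Gal) ↔ LDeltaCovered 𝔉 P := Iff.rfl

end Thm56Sub

end ThetaFrobenioid

end Literature.AnabelianGeometry.EtaleTheta
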